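import Summits.BirchSwinnertonDyer.BirchSwinnertonDyer.Theorems.ThetaPartnerAtTwoPublishedInputsHeckeAtTwoOfFourFacts
import Summits.BirchSwinnertonDyer.BirchSwinnertonDyer.Theorems.ThetaPartnerAtTwoMazurTateCongruenceAtTwoTopOfAliasInputs
import Summits.BirchSwinnertonDyer.BirchSwinnertonDyer.Theorems.ResidualThetaTransportAtTwoThetaLayerLambdaCongruenceAtTwoOfBz
import HarnessLib

/-!
# The PUB⁵ bundle `PublishedInputsHeckeAtTwo` (stmt-BirchSwinnertonDyer-27435) FROM THREE print facts {ES, Bz, AU}, and the K1 crux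
# `MazurTateCongruenceAtTwoTop` (stmt-BirchSwinnertonDyer-25797 = 21416 BY NAME) FROM TWO {Bz, AU} / {Bz, period fact at `2`}:
# the Hecke self-duality conjunct SD = `heckeSelfDual_torsionBy_J0` is now a tree THEOREM
# (INPUTS seat `bsd-input-hecke-selfdual-j0` g0, literature-prover; `--supports stmt-BirchSwinnertonDyer-27435 --as helper`; composition only)

HONEST FRAMING. THEOREMS ONLY, each a one-line composition of landed theorems; no `def`, no `sorry`; nothing here closes an item and
BSD is not proved by any of this. The HOLD item `PublishedInputsHeckeAtTwo` (shared by the routes ThetaPartnerAtTwo and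
ResidualThetaTransportAtTwo) is the conjunction ES ∧ SD ∧ Bz ∧ Se ∧ AU of five named Literature facts. Two of them are DISCHARGED in
the tree:
* Se = `serre1972_supersingular_decompositionSubgroup_image` by
  `Literature.NumberTheory.EllipticCurves.serre1972_supersingular_decompositionSubgroup_image_holds` (bsd-tp2-w8 g0, p645583; booked in
  `…PublishedInputsHeckeAtTwoOfFourFacts`, p646741), and — NEW —
* SD = `Literature.NumberTheory.EllipticCurves.ModularForms.heckeSelfDual_torsionBy_J0` («`J₀(N)[ℓ] ≅ Hom_{𝔽_ℓ}(J₀(N)[ℓ], 𝔽_ℓ)` as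
  `𝕋`-modules», Darmon–Diamond–Taylor 1995 §1.6 Lemma 1.38 reduced mod `ℓ`, §4.5 p. 134) by
  `Summit.BirchSwinnertonDyer.BirchSwinnertonDyer.Theorems.ThetaLayerLambdaCongruenceAtTwo.heckeSelfDual_torsionBy_J0_holds`
  (`…ThetaLayerLambdaCongruenceAtTwoOfBz`, lead bsd-wall-rtt-p3 g13, p661433) :=
  `heckeSelfDual_torsionBy_J0_of_perfectPairing ip_of_crossingPairing_flagSides` — the Hecke-self-adjoint perfect (crossing / intersection)
  pairing on `H₁(X₀(N); ℤ)` assembled in `…ThetaLayerLambdaCongruenceAtTwoHeckeAdjointTranspose` (rtt-p3-w3 g11, p661089) from the RTT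
  cell's bricks HA1–HA8, reduced mod `ℓ` (Merel 1995 §1.2–2.3; Darmon–Diamond–Taylor §1.3, §1.6). Axiom closure re-checked by this seat on
  the farm: {propext, Classical.choice, Quot.sound}.
The other three — Eichler–Shimura period lattice of the depleted optimal quotient (ES), Buzzard 2000 Prop. 2.4 (Bz), Abbes–Ullmo Thm. A
(AU) — remain HYPOTHESES (cite-only, unproved in the tree). Consequences recorded here, by name:
* §1 `thetaPartner_of_esBzAu` / `thetaPartner_iff_esBzAu` (+ the ResidualThetaTransportAtTwo copies): **PUB⁵ ⟺ ES ∧ Bz ∧ AU**;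
* §2 `mazurTateCongruenceAtTwoTop_of_bz_periodTwo` / `…_of_bzAu` / `…_of_aliasInputs_bzPer2` (+ the `MazurTateCongruenceAtTwoR` twins):
  **K1 ⟸ {Bz, period fact at `2`} ⟸ {Bz, AU}** — the TPT twin of RTT's `thetaLayerLambdaCongruenceAtTwo_of_bz` (same `…OfBz` file);
  (Greenberg–Vatsal `μ`-invariance at `2` on the theta habitat from {Bz, period fact at `2`} is then the one-liner
  `flatIff_of_mazurTateCongruenceAtTwoTop h2 (mazurTateCongruenceAtTwoTop_of_bz_periodTwo hBz h2)`, not restated here).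
So the print floor of K1 / of the bundle drops by exactly the SD conjunct; K1 and Kan⁺ stay CONDITIONAL on Buzzard 2000 Prop. 2.4 (+ AU or
the period fact at `2` on the TPT side); no crux or summit statement is settled.

References: H. Darmon, F. Diamond, R. Taylor, *Fermat's Last Theorem* (CDM 1995) §1.3, §1.6 Lemma 1.38, §4.5 p. 134
[DarmonDiamondTaylor1995]; L. Merel, in: Elliptic Curves, Modular Forms & Fermat's Last Theorem (1995) §1.2–1.3, §2.1–2.3 [Merel1995Homologie];
K. Buzzard, MRL 7 (2000) Prop. 2.4 [Buzzard2000LevelLoweringModTwo]; A. Abbes, E. Ullmo, Compositio Math. 103 (1996) Thm. A [AbbesUllmo1996];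
R. Greenberg, V. Vatsal, Invent. Math. 142 (2000) Thm. (1.4), §3 (13) [GreenbergVatsal2000]; J.-P. Serre, Invent. Math. 15 (1972) §1.11
Prop. 12 [SerreInventiones1972].
-/

-- justification: the `Summit.BirchSwinnertonDyer.BirchSwinnertonDyer.…` path repeats a component (route-file convention)
set_option linter.dupNamespace false
set_option autoImplicit false

noncomputable section

open Literature.NumberTheory.EllipticCurves Literature.NumberTheory.EllipticCurves.ModularForms
open Summit.BirchSwinnertonDyer.BirchSwinnertonDyer.Theorems.ThetaLayerLambdaCongruenceAtTwo (heckeSelfDual_torsionBy_J0_holds)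

/-! ## §1 PUB⁵ ⟺ ES ∧ Bz ∧ AU (both routes' copies of item 27435) -/

namespace Summit.BirchSwinnertonDyer.BirchSwinnertonDyer.Theorems.PublishedInputsHeckeAtTwo

/-- **PUB³ ⟹ PUB⁵ (route ThetaPartnerAtTwo)**: `PublishedInputsHeckeAtTwo` from Eichler–Shimura (depleted optimal quotient), Buzzard 2000
and Abbes–Ullmo Thm. A — the Hecke self-duality conjunct is supplied by the tree theorem `heckeSelfDual_torsionBy_J0_holds` and the Serre 1972
conjunct by `serre1972_supersingular_decompositionSubgroup_image_holds`. CONDITIONAL on {ES, Bz, AU}; BSD is not proved by this.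
[cite: DarmonDiamondTaylor1995, §1.6 Lemma 1.38 and §4.5 (p. 134)] [cite: SerreInventiones1972, §1.11 Prop. 12 (c),(d)] -/
theorem thetaPartner_of_esBzAu
    (hES : eichlerShimura_depletedOptimalQuotient_periodLattice_of_dvd) (hBz : buzzard2000_multiplicityOne_gamma0)
    (hAU : abbesUllmo_not_dvd_maninConstant_of_not_dvd_level) :
    Summit.BirchSwinnertonDyer.BirchSwinnertonDyer.Theses.ThetaPartnerAtTwo.PublishedInputsHeckeAtTwo :=
  thetaPartner_of_esSdBzAu hES heckeSelfDual_torsionBy_J0_holds hBz hAU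

/-- **PUB⁵ ⟺ PUB³ (route ThetaPartnerAtTwo)**: the HOLD bundle is EQUIVALENT to the conjunction of its three unproved conjuncts
ES ∧ Bz ∧ AU. [cite: DarmonDiamondTaylor1995, §1.6 Lemma 1.38 and §4.5 (p. 134)] [cite: SerreInventiones1972, §1.11 Prop. 12 (c),(d)] -/
theorem thetaPartner_iff_esBzAu :
    Summit.BirchSwinnertonDyer.BirchSwinnertonDyer.Theses.ThetaPartnerAtTwo.PublishedInputsHeckeAtTwo ↔
      eichlerShimura_depletedOptimalQuotient_periodLattice_of_dvd ∧ buzzard2000_multiplicityOne_gamma0 ∧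
        abbesUllmo_not_dvd_maninConstant_of_not_dvd_level :=
  ⟨fun h ↦ ⟨h.1, h.2.2.1, h.2.2.2.2⟩, fun h ↦ thetaPartner_of_esBzAu h.1 h.2.1 h.2.2⟩

/-- **PUB³ ⟹ PUB⁵ (route ResidualThetaTransportAtTwo's copy of the same item)**. CONDITIONAL on {ES, Bz, AU}; BSD is not proved by this.
[cite: DarmonDiamondTaylor1995, §1.6 Lemma 1.38 and §4.5 (p. 134)] [cite: SerreInventiones1972, §1.11 Prop. 12 (c),(d)] -/
theorem residualThetaTransport_of_esBzAu
    (hES : eichlerShimura_depletedOptimalQuotient_periodLattice_of_dvd) (hBz : buzzard2000_multiplicityOne_gamma0)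
    (hAU : abbesUllmo_not_dvd_maninConstant_of_not_dvd_level) :
    Summit.BirchSwinnertonDyer.BirchSwinnertonDyer.Theses.ResidualThetaTransportAtTwo.PublishedInputsHeckeAtTwo :=
  residualThetaTransport_of_esSdBzAu hES heckeSelfDual_torsionBy_J0_holds hBz hAU

/-- **PUB⁵ ⟺ PUB³ (route ResidualThetaTransportAtTwo's copy)**.
[cite: DarmonDiamondTaylor1995, §1.6 Lemma 1.38 and §4.5 (p. 134)] [cite: SerreInventiones1972, §1.11 Prop. 12 (c),(d)] -/
theorem residualThetaTransport_iff_esBzAu :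
    Summit.BirchSwinnertonDyer.BirchSwinnertonDyer.Theses.ResidualThetaTransportAtTwo.PublishedInputsHeckeAtTwo ↔
      eichlerShimura_depletedOptimalQuotient_periodLattice_of_dvd ∧ buzzard2000_multiplicityOne_gamma0 ∧
        abbesUllmo_not_dvd_maninConstant_of_not_dvd_level :=
  ⟨fun h ↦ ⟨h.1, h.2.2.1, h.2.2.2.2⟩, fun h ↦ residualThetaTransport_of_esBzAu h.1 h.2.1 h.2.2⟩

end Summit.BirchSwinnertonDyer.BirchSwinnertonDyer.Theorems.PublishedInputsHeckeAtTwo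

/-! ## §2 K1 `MazurTateCongruenceAtTwoTop` (25797) and its twin `MazurTateCongruenceAtTwoR` (21416) with SD discharged -/

namespace Summit.BirchSwinnertonDyer.BirchSwinnertonDyer.Theorems.MazurTateCongruenceAtTwoR

open Summit.BirchSwinnertonDyer.BirchSwinnertonDyer.Theses.ThetaPartnerAtTwo

/-- **K1 BY NAME from Buzzard 2000 Prop. 2.4 + the period fact at `2`** (`mazurTateCongruenceAtTwoTop_of_sdBz_periodTwo` with the Hecke
self-duality binder supplied by the theorem `heckeSelfDual_torsionBy_J0_holds`). CONDITIONAL on {Bz, `realPeriodRat_eq_unit_mul_plusPeriod_two`};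
BSD is not proved by this. [cite: Buzzard2000LevelLoweringModTwo, Prop. 2.4] [cite: GreenbergVatsal2000, Thm. (1.4), §3 (13)]
[cite: DarmonDiamondTaylor1995, §1.6 Lemma 1.38 and §4.5 (p. 134)] -/
theorem mazurTateCongruenceAtTwoTop_of_bz_periodTwo
    (hBz : buzzard2000_multiplicityOne_gamma0) (h2 : realPeriodRat_eq_unit_mul_plusPeriod_two) :
    MazurTateCongruenceAtTwoTop :=
  mazurTateCongruenceAtTwoTop_of_sdBz_periodTwo heckeSelfDual_torsionBy_J0_holds hBz h2

/-- **K1 BY NAME from TWO print facts {Bz, AU}** (`mazurTateCongruenceAtTwoTop_of_sdBzAu` with SD discharged): the K1 print floor after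
the SD kernel road. CONDITIONAL on {Bz, AU}; BSD is not proved by this. [cite: Buzzard2000LevelLoweringModTwo, Prop. 2.4]
[cite: AbbesUllmo1996, Thm. A] [cite: DarmonDiamondTaylor1995, §1.6 Lemma 1.38 and §4.5 (p. 134)] -/
theorem mazurTateCongruenceAtTwoTop_of_bzAu
    (hBz : buzzard2000_multiplicityOne_gamma0) (hAU : abbesUllmo_not_dvd_maninConstant_of_not_dvd_level) :
    MazurTateCongruenceAtTwoTop :=
  mazurTateCongruenceAtTwoTop_of_sdBzAu heckeSelfDual_torsionBy_J0_holds hBz hAU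

/-- **K1 BY NAME from the route's TWO single-fact alias items** `BuzzardMultiplicityOneGammaZeroInput` (27798) and
`RealPeriodPlusPeriodUnitAtTwoSupply` (24944) — the third alias `HeckeSelfDualTorsionJ0Input` (27800) of `…_of_aliasInputs` is supplied by
the theorem. CONDITIONAL on the two items; BSD is not proved by this. [cite: Buzzard2000LevelLoweringModTwo, Prop. 2.4]
[cite: GreenbergVatsal2000, §3 (13)] -/
theorem mazurTateCongruenceAtTwoTop_of_aliasInputs_bzPer2 (hBz : BuzzardMultiplicityOneGammaZeroInput)
    (hPer2 : RealPeriodPlusPeriodUnitAtTwoSupply) : MazurTateCongruenceAtTwoTop :=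
  mazurTateCongruenceAtTwoTop_of_aliasInputs heckeSelfDual_torsionBy_J0_holds hBz hPer2

/-- The twin `MazurTateCongruenceAtTwoR` (item 21416) BY NAME from {Bz, period fact at `2`}. CONDITIONAL; BSD is not proved by this.
[cite: Buzzard2000LevelLoweringModTwo, Prop. 2.4] [cite: GreenbergVatsal2000, §3 (13)] -/
theorem mazurTateCongruenceAtTwoR_of_bz_periodTwo
    (hBz : buzzard2000_multiplicityOne_gamma0) (h2 : realPeriodRat_eq_unit_mul_plusPeriod_two) :
    MazurTateCongruenceAtTwoR :=
  mazurTateCongruenceAtTwoTop_of_bz_periodTwo hBz h2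

/-- The twin `MazurTateCongruenceAtTwoR` (item 21416) BY NAME from {Bz, AU}. CONDITIONAL; BSD is not proved by this.
[cite: Buzzard2000LevelLoweringModTwo, Prop. 2.4] [cite: AbbesUllmo1996, Thm. A] -/
theorem mazurTateCongruenceAtTwoR_of_bzAu
    (hBz : buzzard2000_multiplicityOne_gamma0) (hAU : abbesUllmo_not_dvd_maninConstant_of_not_dvd_level) :
    MazurTateCongruenceAtTwoR :=
  mazurTateCongruenceAtTwoTop_of_bzAu hBz hAU

/-- The twin `MazurTateCongruenceAtTwoR` (item 21416) BY NAME from the two alias items 27798 · 24944. CONDITIONAL; BSD is not proved by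
this. [cite: Buzzard2000LevelLoweringModTwo, Prop. 2.4] [cite: GreenbergVatsal2000, §3 (13)] -/
theorem mazurTateCongruenceAtTwoR_of_aliasInputs_bzPer2 (hBz : BuzzardMultiplicityOneGammaZeroInput)
    (hPer2 : RealPeriodPlusPeriodUnitAtTwoSupply) : MazurTateCongruenceAtTwoR :=
  mazurTateCongruenceAtTwoTop_of_aliasInputs_bzPer2 hBz hPer2

end Summit.BirchSwinnertonDyer.BirchSwinnertonDyer.Theorems.MazurTateCongruenceAtTwoR

end
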